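import Mathlib
import Summits.Ventures.PercRepro2.Tail2DBlockCalc
import Summits.Ventures.PercRepro2.Tail2DHarrisSP
import Summits.Ventures.PercRepro2.Tail2DFlowOneBlocks
import Summits.Ventures.PercRepro2.Tail2DFlowOneThreeCounts
import Summits.Ventures.PercRepro2.Tail2DFlowOneThreeTwenty

/-!
# Three flow-one networks in parallel: the certificate at `(2,0)` — target coverage and assembly
(seat mine-b, cell pub-perc-repro2; conjectures/MINE-B.md §43)

The target-side coverage lemmas of the 21-move certificate of `Tail2DFlowOneThreeTwenty.lean` (the target
`E(1,1)` of `(s ∥ t) ∥ r`: an `RRB`-type word receives only its identity term, an `RBB`-type word two relaxed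
`RRR`-moves and two flips, an `RBC`-type word one relaxed move and one flip — the last two use the count identity
`|E'| = 2|E| − 2A`), and the assembly `cert3_20 : E(2,0) ≼ E(1,1)`.
-/

namespace Summit.Ventures.PercRepro2.Tail2D

open V2Closure Finset

section TwentyB

variable (s t r : V2Closure.SP)

/-- the coverage identity of the `(2,0)` certificate (target side, first factor in `R`) -/
theorem cov20_tgt_R (hs : FlowOne s) (ht : FlowOne t) (hr : FlowOne r) (ha : 0 < (rSet s).card)
    (ha' : 0 < (rSet t).card) (ha'' : 0 < (rSet r).card) (q : (V2Closure.SP.par s t).Conf) (z : r.Conf)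
    (hx : s.rLab q.1 = 1 ∧ s.bLab q.1 = 0) :
    ∑ k : Fin 21, cert20W s t r k * unifDens (V2Closure.SP.par (V2Closure.SP.par s t) r) (cert20A' s t k ×ˢ cert20B' r k) ((q, z) : (V2Closure.SP.par s t).Conf × r.Conf)
      = unifDens (V2Closure.SP.par (V2Closure.SP.par s t) r) (tailSet (V2Closure.SP.par (V2Closure.SP.par s t) r) 1 1) ((q, z) : (V2Closure.SP.par s t).Conf × r.Conf) := by
  obtain ⟨hB, hCol, -, -, hRne, hBne, hColne, -⟩ := counts s hs ha
  obtain ⟨hB', hCol', -, -, hR'ne, hB'ne, hCol'ne, -⟩ := counts t ht ha'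
  obtain ⟨hB'', hCol'', -, -, hR''ne, hB''ne, hCol''ne, -⟩ := counts r hr ha''
  have ha0 : ((rSet s).card : ℚ) ≠ 0 := by exact_mod_cast ne_of_gt ha
  have ha'0 : ((rSet t).card : ℚ) ≠ 0 := by exact_mod_cast ne_of_gt ha'
  have ha''0 : ((rSet r).card : ℚ) ≠ 0 := by exact_mod_cast ne_of_gt ha''
  have hcols := card_colSet' s hs; have hcolt := card_colSet' t ht; have hcolr := card_colSet' r hr
  have hcol0 : ((rSet s).card : ℚ) + (cellSet s).card ≠ 0 := by
    have h : ((colSet s).card : ℚ) ≠ 0 := by exact_mod_cast ne_of_gt (Finset.card_pos.2 hColne)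
    rwa [hcols, Nat.cast_add] at h
  have hcol'0 : ((rSet t).card : ℚ) + (cellSet t).card ≠ 0 := by
    have h : ((colSet t).card : ℚ) ≠ 0 := by exact_mod_cast ne_of_gt (Finset.card_pos.2 hCol'ne)
    rwa [hcolt, Nat.cast_add] at h
  have hcol''0 : ((rSet r).card : ℚ) + (cellSet r).card ≠ 0 := by
    have h : ((colSet r).card : ℚ) ≠ 0 := by exact_mod_cast ne_of_gt (Finset.card_pos.2 hCol''ne)
    rwa [hcolr, Nat.cast_add] at h
  have hE20q := count20q s t r hs ht hr
  have hE11q := count11q s t r hs ht hr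
  have hEpos := count20_pos s t r hs ht hr ha ha' ha''
  have hE'pos := count11_pos s t r hs ht hr ha ha' ha''
  have hE0 : (tailCount (V2Closure.SP.par (V2Closure.SP.par s t) r) 2 0 : ℚ) ≠ 0 := ne_of_gt hEpos
  have hE'0 : (tailCount (V2Closure.SP.par (V2Closure.SP.par s t) r) 1 1 : ℚ) ≠ 0 := ne_of_gt hE'pos
  have hE0p := hE0; rw [hE20q] at hE0p
  have hE'0p := hE'0; rw [hE11q] at hE'0p
  simp only [Fin.sum_univ_succ, Fin.sum_univ_zero, cert20W, cert20A', cert20B', Matrix.cons_val_zero,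
      Matrix.cons_val_succ, unifDens_par_prod, unifDens_par_tail, mem_pair_prod, card_pair_prod, rLab_par, bLab_par,
      mem_rSet, mem_bSet, mem_colSet, mem_cellSet, hB, hB', hB'', hcols, hcolt, hcolr, Nat.cast_add, Nat.cast_mul]
  rcases flowOne_cases t ht q.2 with hy | hy | hy <;> rcases flowOne_cases r hr z with hz | hz | hz
  · simp (config := { decide := true }) [hx.1, hx.2, hy.1, hy.2, hz.1, hz.2]
  · simp (config := { decide := true }) [hx.1, hx.2, hy.1, hy.2, hz.1, hz.2]
    field_simp
  · simp (config := { decide := true }) [hx.1, hx.2, hy.1, hy.2, hz.1, hz.2]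
  · simp (config := { decide := true }) [hx.1, hx.2, hy.1, hy.2, hz.1, hz.2]
    field_simp
  · simp (config := { decide := true }) [hx.1, hx.2, hy.1, hy.2, hz.1, hz.2]
    field_simp
    rw [hE20q, hE11q]
    ring
  · have hcr0 : ((cellSet r).card : ℚ) ≠ 0 := by
      exact_mod_cast ne_of_gt (Finset.card_pos.2 ⟨z, (by rw [mem_cellSet]; exact hz)⟩)
    simp (config := { decide := true }) [hx.1, hx.2, hy.1, hy.2, hz.1, hz.2]
    field_simp
    rw [hE20q, hE11q]
    ring
  · simp (config := { decide := true }) [hx.1, hx.2, hy.1, hy.2, hz.1, hz.2]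
  · have hct0 : ((cellSet t).card : ℚ) ≠ 0 := by
      exact_mod_cast ne_of_gt (Finset.card_pos.2 ⟨q.2, (by rw [mem_cellSet]; exact hy)⟩)
    simp (config := { decide := true }) [hx.1, hx.2, hy.1, hy.2, hz.1, hz.2]
    field_simp
    rw [hE20q, hE11q]
    ring
  · simp (config := { decide := true }) [hx.1, hx.2, hy.1, hy.2, hz.1, hz.2]
/-- the coverage identity of the `(2,0)` certificate (target side, first factor in `B`) -/
theorem cov20_tgt_B (hs : FlowOne s) (ht : FlowOne t) (hr : FlowOne r) (ha : 0 < (rSet s).card)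
    (ha' : 0 < (rSet t).card) (ha'' : 0 < (rSet r).card) (q : (V2Closure.SP.par s t).Conf) (z : r.Conf)
    (hx : s.rLab q.1 = 0 ∧ s.bLab q.1 = 1) :
    ∑ k : Fin 21, cert20W s t r k * unifDens (V2Closure.SP.par (V2Closure.SP.par s t) r) (cert20A' s t k ×ˢ cert20B' r k) ((q, z) : (V2Closure.SP.par s t).Conf × r.Conf)
      = unifDens (V2Closure.SP.par (V2Closure.SP.par s t) r) (tailSet (V2Closure.SP.par (V2Closure.SP.par s t) r) 1 1) ((q, z) : (V2Closure.SP.par s t).Conf × r.Conf) := by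
  obtain ⟨hB, hCol, -, -, hRne, hBne, hColne, -⟩ := counts s hs ha
  obtain ⟨hB', hCol', -, -, hR'ne, hB'ne, hCol'ne, -⟩ := counts t ht ha'
  obtain ⟨hB'', hCol'', -, -, hR''ne, hB''ne, hCol''ne, -⟩ := counts r hr ha''
  have ha0 : ((rSet s).card : ℚ) ≠ 0 := by exact_mod_cast ne_of_gt ha
  have ha'0 : ((rSet t).card : ℚ) ≠ 0 := by exact_mod_cast ne_of_gt ha'
  have ha''0 : ((rSet r).card : ℚ) ≠ 0 := by exact_mod_cast ne_of_gt ha''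
  have hcols := card_colSet' s hs; have hcolt := card_colSet' t ht; have hcolr := card_colSet' r hr
  have hcol0 : ((rSet s).card : ℚ) + (cellSet s).card ≠ 0 := by
    have h : ((colSet s).card : ℚ) ≠ 0 := by exact_mod_cast ne_of_gt (Finset.card_pos.2 hColne)
    rwa [hcols, Nat.cast_add] at h
  have hcol'0 : ((rSet t).card : ℚ) + (cellSet t).card ≠ 0 := by
    have h : ((colSet t).card : ℚ) ≠ 0 := by exact_mod_cast ne_of_gt (Finset.card_pos.2 hCol'ne)
    rwa [hcolt, Nat.cast_add] at h
  have hcol''0 : ((rSet r).card : ℚ) + (cellSet r).card ≠ 0 := by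
    have h : ((colSet r).card : ℚ) ≠ 0 := by exact_mod_cast ne_of_gt (Finset.card_pos.2 hCol''ne)
    rwa [hcolr, Nat.cast_add] at h
  have hE20q := count20q s t r hs ht hr
  have hE11q := count11q s t r hs ht hr
  have hEpos := count20_pos s t r hs ht hr ha ha' ha''
  have hE'pos := count11_pos s t r hs ht hr ha ha' ha''
  have hE0 : (tailCount (V2Closure.SP.par (V2Closure.SP.par s t) r) 2 0 : ℚ) ≠ 0 := ne_of_gt hEpos
  have hE'0 : (tailCount (V2Closure.SP.par (V2Closure.SP.par s t) r) 1 1 : ℚ) ≠ 0 := ne_of_gt hE'pos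
  have hE0p := hE0; rw [hE20q] at hE0p
  have hE'0p := hE'0; rw [hE11q] at hE'0p
  simp only [Fin.sum_univ_succ, Fin.sum_univ_zero, cert20W, cert20A', cert20B', Matrix.cons_val_zero,
      Matrix.cons_val_succ, unifDens_par_prod, unifDens_par_tail, mem_pair_prod, card_pair_prod, rLab_par, bLab_par,
      mem_rSet, mem_bSet, mem_colSet, mem_cellSet, hB, hB', hB'', hcols, hcolt, hcolr, Nat.cast_add, Nat.cast_mul]
  rcases flowOne_cases t ht q.2 with hy | hy | hy <;> rcases flowOne_cases r hr z with hz | hz | hz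
  · simp (config := { decide := true }) [hx.1, hx.2, hy.1, hy.2, hz.1, hz.2]
    field_simp
  · simp (config := { decide := true }) [hx.1, hx.2, hy.1, hy.2, hz.1, hz.2]
    field_simp
    rw [hE20q, hE11q]
    ring
  · have hcr0 : ((cellSet r).card : ℚ) ≠ 0 := by
      exact_mod_cast ne_of_gt (Finset.card_pos.2 ⟨z, (by rw [mem_cellSet]; exact hz)⟩)
    simp (config := { decide := true }) [hx.1, hx.2, hy.1, hy.2, hz.1, hz.2]
    field_simp
    rw [hE20q, hE11q]
    ring
  · simp (config := { decide := true }) [hx.1, hx.2, hy.1, hy.2, hz.1, hz.2]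
    field_simp
    rw [hE20q, hE11q]
    ring
  · simp (config := { decide := true }) [hx.1, hx.2, hy.1, hy.2, hz.1, hz.2]
  · simp (config := { decide := true }) [hx.1, hx.2, hy.1, hy.2, hz.1, hz.2]
  · have hct0 : ((cellSet t).card : ℚ) ≠ 0 := by
      exact_mod_cast ne_of_gt (Finset.card_pos.2 ⟨q.2, (by rw [mem_cellSet]; exact hy)⟩)
    simp (config := { decide := true }) [hx.1, hx.2, hy.1, hy.2, hz.1, hz.2]
    field_simp
    rw [hE20q, hE11q]
    ring
  · simp (config := { decide := true }) [hx.1, hx.2, hy.1, hy.2, hz.1, hz.2]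
  · simp (config := { decide := true }) [hx.1, hx.2, hy.1, hy.2, hz.1, hz.2]
/-- the coverage identity of the `(2,0)` certificate (target side, first factor in `C`) -/
theorem cov20_tgt_C (hs : FlowOne s) (ht : FlowOne t) (hr : FlowOne r) (ha : 0 < (rSet s).card)
    (ha' : 0 < (rSet t).card) (ha'' : 0 < (rSet r).card) (q : (V2Closure.SP.par s t).Conf) (z : r.Conf)
    (hx : s.rLab q.1 = 0 ∧ s.bLab q.1 = 0) :
    ∑ k : Fin 21, cert20W s t r k * unifDens (V2Closure.SP.par (V2Closure.SP.par s t) r) (cert20A' s t k ×ˢ cert20B' r k) ((q, z) : (V2Closure.SP.par s t).Conf × r.Conf)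
      = unifDens (V2Closure.SP.par (V2Closure.SP.par s t) r) (tailSet (V2Closure.SP.par (V2Closure.SP.par s t) r) 1 1) ((q, z) : (V2Closure.SP.par s t).Conf × r.Conf) := by
  obtain ⟨hB, hCol, -, -, hRne, hBne, hColne, -⟩ := counts s hs ha
  obtain ⟨hB', hCol', -, -, hR'ne, hB'ne, hCol'ne, -⟩ := counts t ht ha'
  obtain ⟨hB'', hCol'', -, -, hR''ne, hB''ne, hCol''ne, -⟩ := counts r hr ha''
  have ha0 : ((rSet s).card : ℚ) ≠ 0 := by exact_mod_cast ne_of_gt ha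
  have ha'0 : ((rSet t).card : ℚ) ≠ 0 := by exact_mod_cast ne_of_gt ha'
  have ha''0 : ((rSet r).card : ℚ) ≠ 0 := by exact_mod_cast ne_of_gt ha''
  have hcols := card_colSet' s hs; have hcolt := card_colSet' t ht; have hcolr := card_colSet' r hr
  have hcol0 : ((rSet s).card : ℚ) + (cellSet s).card ≠ 0 := by
    have h : ((colSet s).card : ℚ) ≠ 0 := by exact_mod_cast ne_of_gt (Finset.card_pos.2 hColne)
    rwa [hcols, Nat.cast_add] at h
  have hcol'0 : ((rSet t).card : ℚ) + (cellSet t).card ≠ 0 := by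
    have h : ((colSet t).card : ℚ) ≠ 0 := by exact_mod_cast ne_of_gt (Finset.card_pos.2 hCol'ne)
    rwa [hcolt, Nat.cast_add] at h
  have hcol''0 : ((rSet r).card : ℚ) + (cellSet r).card ≠ 0 := by
    have h : ((colSet r).card : ℚ) ≠ 0 := by exact_mod_cast ne_of_gt (Finset.card_pos.2 hCol''ne)
    rwa [hcolr, Nat.cast_add] at h
  have hE20q := count20q s t r hs ht hr
  have hE11q := count11q s t r hs ht hr
  have hEpos := count20_pos s t r hs ht hr ha ha' ha''
  have hE'pos := count11_pos s t r hs ht hr ha ha' ha''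
  have hE0 : (tailCount (V2Closure.SP.par (V2Closure.SP.par s t) r) 2 0 : ℚ) ≠ 0 := ne_of_gt hEpos
  have hE'0 : (tailCount (V2Closure.SP.par (V2Closure.SP.par s t) r) 1 1 : ℚ) ≠ 0 := ne_of_gt hE'pos
  have hE0p := hE0; rw [hE20q] at hE0p
  have hE'0p := hE'0; rw [hE11q] at hE'0p
  have hcs0 : ((cellSet s).card : ℚ) ≠ 0 := by
    exact_mod_cast ne_of_gt (Finset.card_pos.2 ⟨q.1, by rw [mem_cellSet]; exact hx⟩)
  simp only [Fin.sum_univ_succ, Fin.sum_univ_zero, cert20W, cert20A', cert20B', Matrix.cons_val_zero,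
      Matrix.cons_val_succ, unifDens_par_prod, unifDens_par_tail, mem_pair_prod, card_pair_prod, rLab_par, bLab_par,
      mem_rSet, mem_bSet, mem_colSet, mem_cellSet, hB, hB', hB'', hcols, hcolt, hcolr, Nat.cast_add, Nat.cast_mul]
  rcases flowOne_cases t ht q.2 with hy | hy | hy <;> rcases flowOne_cases r hr z with hz | hz | hz
  · simp (config := { decide := true }) [hx.1, hx.2, hy.1, hy.2, hz.1, hz.2]
  · simp (config := { decide := true }) [hx.1, hx.2, hy.1, hy.2, hz.1, hz.2]
    field_simp
    rw [hE20q, hE11q]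
    ring
  · simp (config := { decide := true }) [hx.1, hx.2, hy.1, hy.2, hz.1, hz.2]
  · simp (config := { decide := true }) [hx.1, hx.2, hy.1, hy.2, hz.1, hz.2]
    field_simp
    rw [hE20q, hE11q]
    ring
  · simp (config := { decide := true }) [hx.1, hx.2, hy.1, hy.2, hz.1, hz.2]
  · simp (config := { decide := true }) [hx.1, hx.2, hy.1, hy.2, hz.1, hz.2]
  · simp (config := { decide := true }) [hx.1, hx.2, hy.1, hy.2, hz.1, hz.2]
  · simp (config := { decide := true }) [hx.1, hx.2, hy.1, hy.2, hz.1, hz.2]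
  · simp (config := { decide := true }) [hx.1, hx.2, hy.1, hy.2, hz.1, hz.2]
/-- **the certificate at `(2,0)`**: `E(2,0) ≼ E(1,1)` on `(s ∥ t) ∥ r` for three flow-one networks with red
crossings — the 21 product-block moves of `cert20A/A'/B/B'` with the weights `cert20W` -/
theorem cert3_20 (hs : FlowOne s) (ht : FlowOne t) (hr : FlowOne r) (ha : 0 < (rSet s).card)
    (ha' : 0 < (rSet t).card) (ha'' : 0 < (rSet r).card) :
    BlockDom (V2Closure.SP.par (V2Closure.SP.par s t) r) (tailSet (V2Closure.SP.par (V2Closure.SP.par s t) r) 2 0) (tailSet (V2Closure.SP.par (V2Closure.SP.par s t) r) 1 1) := by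
  obtain ⟨hB, hCol, -, -, hRne, hBne, hColne, -⟩ := counts s hs ha
  obtain ⟨hB', hCol', -, -, hR'ne, hB'ne, hCol'ne, -⟩ := counts t ht ha'
  obtain ⟨hB'', hCol'', -, -, hR''ne, hB''ne, hCol''ne, -⟩ := counts r hr ha''
  have ha0 : ((rSet s).card : ℚ) ≠ 0 := by exact_mod_cast ne_of_gt ha
  have ha'0 : ((rSet t).card : ℚ) ≠ 0 := by exact_mod_cast ne_of_gt ha'
  have ha''0 : ((rSet r).card : ℚ) ≠ 0 := by exact_mod_cast ne_of_gt ha''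
  have hcols := card_colSet' s hs; have hcolt := card_colSet' t ht; have hcolr := card_colSet' r hr
  have hcol0 : ((rSet s).card : ℚ) + (cellSet s).card ≠ 0 := by
    have h : ((colSet s).card : ℚ) ≠ 0 := by exact_mod_cast ne_of_gt (Finset.card_pos.2 hColne)
    rwa [hcols, Nat.cast_add] at h
  have hcol'0 : ((rSet t).card : ℚ) + (cellSet t).card ≠ 0 := by
    have h : ((colSet t).card : ℚ) ≠ 0 := by exact_mod_cast ne_of_gt (Finset.card_pos.2 hCol'ne)
    rwa [hcolt, Nat.cast_add] at h
  have hcol''0 : ((rSet r).card : ℚ) + (cellSet r).card ≠ 0 := by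
    have h : ((colSet r).card : ℚ) ≠ 0 := by exact_mod_cast ne_of_gt (Finset.card_pos.2 hCol''ne)
    rwa [hcolr, Nat.cast_add] at h
  have hE20q := count20q s t r hs ht hr
  have hE11q := count11q s t r hs ht hr
  have hEpos := count20_pos s t r hs ht hr ha ha' ha''
  have hE'pos := count11_pos s t r hs ht hr ha ha' ha''
  have hE0 : (tailCount (V2Closure.SP.par (V2Closure.SP.par s t) r) 2 0 : ℚ) ≠ 0 := ne_of_gt hEpos
  have hE'0 : (tailCount (V2Closure.SP.par (V2Closure.SP.par s t) r) 1 1 : ℚ) ≠ 0 := ne_of_gt hE'pos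
  have hE0p := hE0; rw [hE20q] at hE0p
  have hE'0p := hE'0; rw [hE11q] at hE'0p
  have hexcess := excess20_nonneg s t r hs ht hr ha ha' ha''
  refine blockDom_par_of_certificate (V2Closure.SP.par s t) r (cert20A s t) (cert20A' s t) (cert20B r) (cert20B' r) (cert20W s t r)
    ?_ ?_ ?_ ?_ _ _ ?_ ?_
  · simp only [Fin.forall_fin_succ, cert20W, Matrix.cons_val_zero, Matrix.cons_val_succ, IsEmpty.forall_iff, and_true]
    refine ⟨?_, ?_, ?_, ?_, ?_, ?_, ?_, ?_, ?_, ?_, ?_, ?_, ?_, ?_, ?_, ?_, ?_, ?_, ?_, ?_, ?_⟩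
    · exact div_nonneg (mul_nonneg (mul_nonneg (mul_nonneg (Nat.cast_nonneg _) (Nat.cast_nonneg _)) (Nat.cast_nonneg _)) (mul_nonneg (mul_nonneg (Nat.cast_nonneg _) (Nat.cast_nonneg _)) (Nat.cast_nonneg _))) (mul_nonneg (Nat.cast_nonneg _) (Nat.cast_nonneg _))
    · exact div_nonneg (mul_nonneg (mul_nonneg (mul_nonneg (Nat.cast_nonneg _) (Nat.cast_nonneg _)) (Nat.cast_nonneg _)) (mul_nonneg (mul_nonneg (Nat.cast_nonneg _) (Nat.cast_nonneg _)) (Nat.cast_nonneg _))) (mul_nonneg (Nat.cast_nonneg _) (Nat.cast_nonneg _))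
    · exact div_nonneg (mul_nonneg (mul_nonneg (mul_nonneg (Nat.cast_nonneg _) (Nat.cast_nonneg _)) (Nat.cast_nonneg _)) (mul_nonneg (mul_nonneg (Nat.cast_nonneg _) (Nat.cast_nonneg _)) (Nat.cast_nonneg _))) (mul_nonneg (Nat.cast_nonneg _) (Nat.cast_nonneg _))
    · exact div_nonneg (mul_nonneg (mul_nonneg (mul_nonneg (Nat.cast_nonneg _) (Nat.cast_nonneg _)) (Nat.cast_nonneg _)) (mul_nonneg (mul_nonneg (Nat.cast_nonneg _) (Nat.cast_nonneg _)) (Nat.cast_nonneg _))) (mul_nonneg (Nat.cast_nonneg _) (Nat.cast_nonneg _))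
    · exact div_nonneg (mul_nonneg (mul_nonneg (mul_nonneg (Nat.cast_nonneg _) (Nat.cast_nonneg _)) (Nat.cast_nonneg _)) (mul_nonneg (mul_nonneg (Nat.cast_nonneg _) (Nat.cast_nonneg _)) (Nat.cast_nonneg _))) (mul_nonneg (Nat.cast_nonneg _) (Nat.cast_nonneg _))
    · exact div_nonneg (mul_nonneg (mul_nonneg (mul_nonneg (Nat.cast_nonneg _) (Nat.cast_nonneg _)) (Nat.cast_nonneg _)) (mul_nonneg (mul_nonneg (Nat.cast_nonneg _) (Nat.cast_nonneg _)) (Nat.cast_nonneg _))) (mul_nonneg (Nat.cast_nonneg _) (Nat.cast_nonneg _))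
    · exact div_nonneg (mul_nonneg (mul_nonneg (Nat.cast_nonneg _) (Nat.cast_nonneg _)) (Nat.cast_nonneg _)) (Nat.cast_nonneg _)
    · exact div_nonneg (mul_nonneg (mul_nonneg (Nat.cast_nonneg _) (Nat.cast_nonneg _)) (Nat.cast_nonneg _)) (Nat.cast_nonneg _)
    · exact div_nonneg (mul_nonneg (mul_nonneg (Nat.cast_nonneg _) (Nat.cast_nonneg _)) (Nat.cast_nonneg _)) (Nat.cast_nonneg _)
    · exact div_nonneg (mul_nonneg (mul_nonneg (mul_nonneg (Nat.cast_nonneg _) (Nat.cast_nonneg _)) (Nat.cast_nonneg _)) hexcess) (by norm_num)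
    · exact div_nonneg (mul_nonneg (mul_nonneg (mul_nonneg (Nat.cast_nonneg _) (Nat.cast_nonneg _)) (Nat.cast_nonneg _)) hexcess) (by norm_num)
    · exact div_nonneg (mul_nonneg (mul_nonneg (mul_nonneg (Nat.cast_nonneg _) (Nat.cast_nonneg _)) (Nat.cast_nonneg _)) hexcess) (by norm_num)
    · exact div_nonneg (mul_nonneg (mul_nonneg (mul_nonneg (Nat.cast_nonneg _) (Nat.cast_nonneg _)) (Nat.cast_nonneg _)) hexcess) (by norm_num)
    · exact div_nonneg (mul_nonneg (mul_nonneg (mul_nonneg (Nat.cast_nonneg _) (Nat.cast_nonneg _)) (Nat.cast_nonneg _)) hexcess) (by norm_num)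
    · exact div_nonneg (mul_nonneg (mul_nonneg (mul_nonneg (Nat.cast_nonneg _) (Nat.cast_nonneg _)) (Nat.cast_nonneg _)) hexcess) (by norm_num)
    · exact div_nonneg (mul_nonneg (mul_nonneg (Nat.cast_nonneg _) (Nat.cast_nonneg _)) (Nat.cast_nonneg _)) (mul_nonneg (by norm_num) (Nat.cast_nonneg _))
    · exact div_nonneg (mul_nonneg (mul_nonneg (Nat.cast_nonneg _) (Nat.cast_nonneg _)) (Nat.cast_nonneg _)) (mul_nonneg (by norm_num) (Nat.cast_nonneg _))
    · exact div_nonneg (mul_nonneg (mul_nonneg (Nat.cast_nonneg _) (Nat.cast_nonneg _)) (Nat.cast_nonneg _)) (mul_nonneg (by norm_num) (Nat.cast_nonneg _))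
    · exact div_nonneg (mul_nonneg (mul_nonneg (Nat.cast_nonneg _) (Nat.cast_nonneg _)) (Nat.cast_nonneg _)) (mul_nonneg (by norm_num) (Nat.cast_nonneg _))
    · exact div_nonneg (mul_nonneg (mul_nonneg (Nat.cast_nonneg _) (Nat.cast_nonneg _)) (Nat.cast_nonneg _)) (mul_nonneg (by norm_num) (Nat.cast_nonneg _))
    · exact div_nonneg (mul_nonneg (mul_nonneg (Nat.cast_nonneg _) (Nat.cast_nonneg _)) (Nat.cast_nonneg _)) (mul_nonneg (by norm_num) (Nat.cast_nonneg _))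
  · simp only [Fin.forall_fin_succ, cert20A, cert20A', Matrix.cons_val_zero, Matrix.cons_val_succ, IsEmpty.forall_iff, and_true]
    refine ⟨?_, ?_, ?_, ?_, ?_, ?_, ?_, ?_, ?_, ?_, ?_, ?_, ?_, ?_, ?_, ?_, ?_, ?_, ?_, ?_, ?_⟩
    · exact blockDom_prod_par s t (dom_r_b s) (dom_r_col t)
    · exact blockDom_prod_par s t (dom_r_b s) (blockDom_refl _ _)
    · exact blockDom_prod_par s t (dom_r_col s) (dom_r_b t)
    · exact blockDom_prod_par s t (blockDom_refl _ _) (dom_r_b t)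
    · exact blockDom_prod_par s t (dom_r_col s) (blockDom_refl _ _)
    · exact blockDom_prod_par s t (blockDom_refl _ _) (dom_r_col t)
    · exact blockDom_refl _ _
    · exact blockDom_refl _ _
    · exact blockDom_refl _ _
    · exact blockDom_prod_par s t (blockDom_refl _ _) (dom_r_b t)
    · exact blockDom_refl _ _
    · exact blockDom_prod_par s t (dom_r_b s) (blockDom_refl _ _)
    · exact blockDom_refl _ _
    · exact blockDom_prod_par s t (dom_r_b s) (blockDom_refl _ _)
    · exact blockDom_prod_par s t (blockDom_refl _ _) (dom_r_b t)
    · exact blockDom_prod_par s t (blockDom_refl _ _) (dom_r_b t)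
    · exact blockDom_refl _ _
    · exact blockDom_prod_par s t (dom_r_b s) (blockDom_refl _ _)
    · exact blockDom_refl _ _
    · exact blockDom_prod_par s t (dom_r_b s) (blockDom_refl _ _)
    · exact blockDom_prod_par s t (blockDom_refl _ _) (dom_r_b t)
  · simp only [Fin.forall_fin_succ, cert20B, cert20B', Matrix.cons_val_zero, Matrix.cons_val_succ, IsEmpty.forall_iff, and_true]
    refine ⟨?_, ?_, ?_, ?_, ?_, ?_, ?_, ?_, ?_, ?_, ?_, ?_, ?_, ?_, ?_, ?_, ?_, ?_, ?_, ?_, ?_⟩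
    · exact blockDom_refl _ _
    · exact dom_r_col r
    · exact blockDom_refl _ _
    · exact dom_r_col r
    · exact dom_r_b r
    · exact dom_r_b r
    · exact blockDom_refl _ _
    · exact blockDom_refl _ _
    · exact blockDom_refl _ _
    · exact blockDom_refl _ _
    · exact dom_r_b r
    · exact blockDom_refl _ _
    · exact dom_r_b r
    · exact blockDom_refl _ _
    · exact blockDom_refl _ _
    · exact blockDom_refl _ _
    · exact dom_r_b r
    · exact blockDom_refl _ _
    · exact dom_r_b r
    · exact blockDom_refl _ _
    · exact blockDom_refl _ _
  · simp only [Fin.forall_fin_succ, cert20A, cert20A', cert20B, cert20B', cert20W, Matrix.cons_val_zero, Matrix.cons_val_succ,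
      IsEmpty.forall_iff, and_true]
    refine ⟨?_, ?_, ?_, ?_, ?_, ?_, ?_, ?_, ?_, ?_, ?_, ?_, ?_, ?_, ?_, ?_, ?_, ?_, ?_, ?_, ?_⟩
    · intro _ _
      exact Finset.nonempty_product.2 ⟨Finset.nonempty_product.2 ⟨hBne, hCol'ne⟩, hR''ne⟩
    · intro _ _
      exact Finset.nonempty_product.2 ⟨Finset.nonempty_product.2 ⟨hBne, hR'ne⟩, hCol''ne⟩
    · intro _ _
      exact Finset.nonempty_product.2 ⟨Finset.nonempty_product.2 ⟨hColne, hB'ne⟩, hR''ne⟩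
    · intro _ _
      exact Finset.nonempty_product.2 ⟨Finset.nonempty_product.2 ⟨hRne, hB'ne⟩, hCol''ne⟩
    · intro _ _
      exact Finset.nonempty_product.2 ⟨Finset.nonempty_product.2 ⟨hColne, hR'ne⟩, hB''ne⟩
    · intro _ _
      exact Finset.nonempty_product.2 ⟨Finset.nonempty_product.2 ⟨hRne, hCol'ne⟩, hB''ne⟩
    · intro _ _
      exact Finset.nonempty_product.2 ⟨Finset.nonempty_product.2 ⟨hBne, hR'ne⟩, hR''ne⟩
    · intro _ _
      exact Finset.nonempty_product.2 ⟨Finset.nonempty_product.2 ⟨hRne, hB'ne⟩, hR''ne⟩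
    · intro _ _
      exact Finset.nonempty_product.2 ⟨Finset.nonempty_product.2 ⟨hRne, hR'ne⟩, hB''ne⟩
    · intro _ _
      exact Finset.nonempty_product.2 ⟨Finset.nonempty_product.2 ⟨hBne, hB'ne⟩, hR''ne⟩
    · intro _ _
      exact Finset.nonempty_product.2 ⟨Finset.nonempty_product.2 ⟨hBne, hR'ne⟩, hB''ne⟩
    · intro _ _
      exact Finset.nonempty_product.2 ⟨Finset.nonempty_product.2 ⟨hBne, hB'ne⟩, hR''ne⟩
    · intro _ _
      exact Finset.nonempty_product.2 ⟨Finset.nonempty_product.2 ⟨hRne, hB'ne⟩, hB''ne⟩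
    · intro _ _
      exact Finset.nonempty_product.2 ⟨Finset.nonempty_product.2 ⟨hBne, hR'ne⟩, hB''ne⟩
    · intro _ _
      exact Finset.nonempty_product.2 ⟨Finset.nonempty_product.2 ⟨hRne, hB'ne⟩, hB''ne⟩
    · intro hk _
      have hc : (cellSet s).Nonempty := by
        apply Finset.card_pos.1
        by_contra h0
        have h0' : (cellSet s).card = 0 := by omega
        rw [h0'] at hk
        simp at hk
      exact Finset.nonempty_product.2 ⟨Finset.nonempty_product.2 ⟨hc, hB'ne⟩, hR''ne⟩
    · intro hk _
      have hc : (cellSet s).Nonempty := by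
        apply Finset.card_pos.1
        by_contra h0
        have h0' : (cellSet s).card = 0 := by omega
        rw [h0'] at hk
        simp at hk
      exact Finset.nonempty_product.2 ⟨Finset.nonempty_product.2 ⟨hc, hR'ne⟩, hB''ne⟩
    · intro hk _
      have hc : (cellSet t).Nonempty := by
        apply Finset.card_pos.1
        by_contra h0
        have h0' : (cellSet t).card = 0 := by omega
        rw [h0'] at hk
        simp at hk
      exact Finset.nonempty_product.2 ⟨Finset.nonempty_product.2 ⟨hBne, hc⟩, hR''ne⟩
    · intro hk _
      have hc : (cellSet t).Nonempty := by
        apply Finset.card_pos.1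
        by_contra h0
        have h0' : (cellSet t).card = 0 := by omega
        rw [h0'] at hk
        simp at hk
      exact Finset.nonempty_product.2 ⟨Finset.nonempty_product.2 ⟨hRne, hc⟩, hB''ne⟩
    · intro hk _
      have hc : (cellSet r).Nonempty := by
        apply Finset.card_pos.1
        by_contra h0
        have h0' : (cellSet r).card = 0 := by omega
        rw [h0'] at hk
        simp at hk
      exact Finset.nonempty_product.2 ⟨Finset.nonempty_product.2 ⟨hBne, hR'ne⟩, hc⟩
    · intro hk _
      have hc : (cellSet r).Nonempty := by
        apply Finset.card_pos.1
        by_contra h0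
        have h0' : (cellSet r).card = 0 := by omega
        rw [h0'] at hk
        simp at hk
      exact Finset.nonempty_product.2 ⟨Finset.nonempty_product.2 ⟨hRne, hB'ne⟩, hc⟩
  · rintro ⟨q, z⟩
    rcases flowOne_cases s hs q.1 with hx | hx | hx
    · exact cov20_src_R s t r hs ht hr ha ha' ha'' q z hx
    · exact cov20_src_B s t r hs ht hr ha ha' ha'' q z hx
    · exact cov20_src_C s t r hs ht hr ha ha' ha'' q z hx
  · rintro ⟨q, z⟩
    rcases flowOne_cases s hs q.1 with hx | hx | hx
    · exact cov20_tgt_R s t r hs ht hr ha ha' ha'' q z hx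
    · exact cov20_tgt_B s t r hs ht hr ha ha' ha'' q z hx
    · exact cov20_tgt_C s t r hs ht hr ha ha' ha'' q z hx

end TwentyB

end Summit.Ventures.PercRepro2.Tail2D
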